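import Summits.KontsevichZagierPeriods.KontsevichZagierPeriods.Theorems.RootDecompRelativeModAbsoluteRegKernelPairLeOneP03
import Summits.KontsevichZagierPeriods.KontsevichZagierPeriods.Theorems.RootDecompRelativeModAbsoluteRegKernelPairLeOneP04

/-!
(LANDED by the census seat decomp-kz-census-1 g7 `--supports stmt-KontsevichZagierPeriods-30572`; source lens-3 g9 landing package #2, critic decomp-kz-crit-1 g2 CLEARED §14–§17; generic docstrings added where the source had none.)

# `RegKernelPairDegOne` — the transcendence input for TWO monomials (route `RootDecompRelativeModAbsolute`,
towards the rung `k + k' = 2` of support item stmt-KontsevichZagierPeriods-30572) — PROVED · part 5/5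

Cell `decomp-kz`, lens 3 (decomp-kz-lens-3 g9).  After the reduction of part 3 (smooth full-measure locus,
defect `≡ 0`), two regularised log/arctan monomials give at every point a relation
`c₁(x) L₁(x) + c₂(x) L₂(x) = c₀(x)` with `ℚ`-semialgebraic continuous coefficients and
`Lᵢ ∈ {log wᵢ, arctan dᵢ}`.  Part 4: Baker for two logarithms in scalar form (`CircleBaker.two_term`,
`two_logs`, `two_arctans`, `log_arctan`: the constant term vanishes; a non-trivial relation has a RATIONAL
coefficient ratio; mixed log/arctan relations are trivial).  Part 5: the function form —
`exists_irrational_isAlgebraic_btwn`, `eqOn_const_of_rational_at_algebraic` (a continuous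
`ℚ`-semialgebraic function of one variable with rational values at all algebraic points of a ball is
constant there: non-interior points of `ℚ`-semialgebraic subsets of the line are algebraic),
`uniform_ratio_two_logs` / `uniform_ratio_two_arctans` (locally `c₁ = q c₂` and `log w₂ = −q log w₁`
with a CONSTANT rational `q` — a uniform multiplicative relation `w₂^n = w₁^{−p}`), `log_arctan_rigid`.
What remains for `k + k' = 2` is the KZ-realisation of the uniform relation by fibrewise
substitution/splitting moves (calculus side).

Source: `HOME/decomp-kz-lens-3/g9/RelativeModAbsoluteDegOneBands.lean` §15 (sha256 fe1756d100ec418f, 6003 l; farm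
rc 0 / 0 warn / 0 sorry; `#print axioms uniform_ratio_two_logs` = propext, Classical.choice, Quot.sound), verbatim,
in the namespace of the landed `RegFoldingDegOne` chain.  No `sorry`; standard axioms.
References: Baker 1975 (Transcendental Number Theory) Thm 2.1 [tree: `baker_holds`]; Bochnak–Coste–Roy 1998 §2.2, §2.9.
-/

noncomputable section

open Set MeasureTheory Filter Topology
open scoped BigOperators
open Literature.NumberTheory.Transcendental Literature.ModelTheory.ExponentialFields

namespace Summit.KontsevichZagierPeriods.RootDecompRelativeModAbsolute.Rung30571

namespace RegularisedLogLayer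


/-! ### Irrational algebraic numbers are dense; rational-valued semialgebraic functions are constant -/

/-- Between two reals there is an IRRATIONAL ALGEBRAIC number (`a + b√2`, `a, b ∈ ℚ`, `b ≠ 0`). -/
theorem exists_irrational_isAlgebraic_btwn {u v : ℝ} (huv : u < v) :
    ∃ y, u < y ∧ y < v ∧ Irrational y ∧ IsAlgebraic ℚ y := by
  obtain ⟨q₁, hq₁, hq₁v⟩ := exists_rat_btwn huv
  obtain ⟨q₂, hq₂, hq₂v⟩ := exists_rat_btwn hq₁v
  have h2 : IsAlgebraic ℚ (Real.sqrt 2) := by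
    refine isAlgebraic_sqrt (by norm_num) ?_
    have := isAlgebraic_algebraMap (R := ℚ) (A := ℝ) 2
    rwa [map_ofNat] at this
  have hs0 : 1 < Real.sqrt 2 := by
    rw [show (1 : ℝ) = Real.sqrt 1 by simp]
    exact Real.sqrt_lt_sqrt (by norm_num) (by norm_num)
  have hs1 : Real.sqrt 2 < 2 := (Real.sqrt_lt' two_pos).2 (by norm_num)
  have hd : (0 : ℝ) < q₂ - q₁ := by
    have : (q₁ : ℝ) < q₂ := hq₂
    linarith
  have a1 : IsAlgebraic ℚ (((2 * q₁ - q₂ : ℚ)) : ℝ) := by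
    have := isAlgebraic_algebraMap (R := ℚ) (A := ℝ) (2 * q₁ - q₂)
    rwa [eq_ratCast] at this
  have a2 : IsAlgebraic ℚ (((q₂ - q₁ : ℚ)) : ℝ) := by
    have := isAlgebraic_algebraMap (R := ℚ) (A := ℝ) (q₂ - q₁)
    rwa [eq_ratCast] at this
  refine ⟨((2 * q₁ - q₂ : ℚ) : ℝ) + ((q₂ - q₁ : ℚ) : ℝ) * Real.sqrt 2, ?_, ?_, ?_, a1.add (a2.mul h2)⟩
  · push_cast
    nlinarith [mul_pos hd (sub_pos.2 hs0)]
  · push_cast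
    nlinarith [mul_lt_mul_of_pos_left (show Real.sqrt 2 - 1 < 1 by linarith) hd]
  · have hq : (q₂ - q₁ : ℚ) ≠ 0 := by
      have : (q₁ : ℝ) < q₂ := hq₂
      exact sub_ne_zero.2 (ne_of_gt (by exact_mod_cast this))
    exact irrational_ratCast_add_iff.2 (irrational_ratCast_mul_iff.2 ⟨hq, irrational_sqrt_two⟩)

/-- Level sets `{x ∈ s | f x = c}` of `ℚ`-semialgebraic functions at ALGEBRAIC levels `c` are
`ℚ`-semialgebraic (graph elimination). [BCR 1998, Prop. 2.2.6] -/
theorem isSemialgebraic_sep_eq_const {b : ℕ} {s : Set (Fin b → ℝ)} {f : (Fin b → ℝ) → ℝ}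
    (hf : IsSemialgebraicFunOn ℚ s f) {c : ℝ} (hc : IsAlgebraic ℚ c) :
    IsSemialgebraic ℚ {x | x ∈ s ∧ f x = c} := by
  have hT : IsSemialgebraic ℚ {z : Fin (b + 1) → ℝ | z (Fin.last b) = c} :=
    isSemialgebraic_setOf_apply_eq_of_isAlgebraic hc (Fin.last b)
  convert hf.isSemialgebraic_sep_snoc_mem tarski_seidenberg_real_holds hT using 1
  ext x
  simp

/-- **Rational-valued `ℚ`-semialgebraic functions of one variable are locally constant.** If `r` is
`ℚ`-semialgebraic on `G ⊇ ball(x₀, ε)`, continuous on the ball, and `r(x) ∈ ℚ` at every ALGEBRAIC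
point `x` of the ball, then `r` is constant on the ball: otherwise, by the intermediate value theorem,
`r` takes an irrational algebraic value `y` at some point `z` of the ball; the level set `{r = y}` is
`ℚ`-semialgebraic, so either it is a neighbourhood of `z` (and then contains an algebraic point, by
density) or `z` itself is algebraic (non-interior points of `ℚ`-semialgebraic subsets of the line are
algebraic) — either way `y = r(a) ∈ ℚ` for an algebraic `a`, a contradiction. [folklore] -/
theorem eqOn_const_of_rational_at_algebraic {G : Set (Fin 1 → ℝ)} (hG : IsSemialgebraic ℚ G)
    {r : (Fin 1 → ℝ) → ℝ} (hr : IsSemialgebraicFunOn ℚ G r) {x₀ : Fin 1 → ℝ} {ε : ℝ}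
    (hball : Metric.ball x₀ ε ⊆ G) (hrc : ContinuousOn r (Metric.ball x₀ ε))
    (hrat : ∀ x ∈ Metric.ball x₀ ε, (∀ i, IsAlgebraic ℚ (x i)) → ∃ q : ℚ, r x = q) :
    ∀ x ∈ Metric.ball x₀ ε, r x = r x₀ := by
  have _ := hG
  intro x hx
  by_contra hne
  -- an irrational algebraic value strictly between `r x` and `r x₀`
  obtain ⟨y, hy₁, hy₂, hyirr, hyalg⟩ := exists_irrational_isAlgebraic_btwn (min_lt_max.2 hne)
  have hεpos : 0 < ε := lt_of_le_of_lt dist_nonneg (Metric.mem_ball.1 hx)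
  -- the segment from `x 0` to `x₀ 0` stays in the ball
  have hpath : ∀ t ∈ uIcc (x 0) (x₀ 0), (fun _ : Fin 1 => t) ∈ Metric.ball x₀ ε := by
    intro t ht
    have hx' := hx
    rw [Metric.mem_ball, dist_pi_lt_iff hεpos] at hx' ⊢
    intro i
    rw [Fin.fin_one_eq_zero i]
    have h0 := hx' 0
    rw [Real.dist_eq, abs_lt] at h0 ⊢
    rcases mem_uIcc.1 ht with ⟨h1, h2⟩ | ⟨h1, h2⟩
    · constructor <;> linarith
    · constructor <;> linarith
  have hφ : ContinuousOn (fun t : ℝ => r (fun _ => t)) (uIcc (x 0) (x₀ 0)) :=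
    hrc.comp (continuous_pi fun _ => continuous_id).continuousOn hpath
  have hxe : (fun _ : Fin 1 => x 0) = x := by
    funext i
    rw [Fin.fin_one_eq_zero i]
  have hx₀e : (fun _ : Fin 1 => x₀ 0) = x₀ := by
    funext i
    rw [Fin.fin_one_eq_zero i]
  have hyI : y ∈ uIcc (r x) (r x₀) := by
    rw [mem_uIcc]
    rcases le_total (r x) (r x₀) with h | h
    · left
      rw [min_eq_left h] at hy₁
      rw [max_eq_right h] at hy₂
      exact ⟨hy₁.le, hy₂.le⟩
    · right
      rw [min_eq_right h] at hy₁
      rw [max_eq_left h] at hy₂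
      exact ⟨hy₁.le, hy₂.le⟩
  obtain ⟨t, ht, hty⟩ : ∃ t ∈ uIcc (x 0) (x₀ 0), r (fun _ => t) = y := by
    have hiv := intermediate_value_uIcc hφ
    simp only [hxe, hx₀e] at hiv
    exact hiv hyI
  set z : Fin 1 → ℝ := fun _ => t with hz
  have hzB : z ∈ Metric.ball x₀ ε := hpath t ht
  have hS : IsSemialgebraic ℚ {w | w ∈ G ∧ r w = y} := isSemialgebraic_sep_eq_const hr hyalg
  have hzS : z ∈ {w | w ∈ G ∧ r w = y} := ⟨hball hzB, hty⟩
  -- an ALGEBRAIC point `a` of the ball with `r a = y`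
  obtain ⟨a, haB, haalg, hay⟩ :
      ∃ a ∈ Metric.ball x₀ ε, (∀ i, IsAlgebraic ℚ (a i)) ∧ r a = y := by
    by_cases hN : {w | w ∈ G ∧ r w = y} ∈ 𝓝 z
    · have hN' : {w | w ∈ G ∧ r w = y} ∩ Metric.ball x₀ ε ∈ 𝓝 z :=
        inter_mem hN (Metric.isOpen_ball.mem_nhds hzB)
      obtain ⟨a, haA, ⟨-, hay⟩, haB⟩ := dense_setOf_isAlgebraic.inter_nhds_nonempty hN'
      exact ⟨a, haB, haA, hay⟩
    · refine ⟨z, hzB, fun i => ?_, hty⟩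
      have := isAlgebraic_of_mem_of_not_mem_nhds hS hzS hN
      simpa [hz] using this
  obtain ⟨q, hq⟩ := hrat a haB haalg
  exact hyirr ⟨q, by rw [← hq, hay]⟩

/-- The density step: a function continuous on an open set of the line that vanishes at all
ALGEBRAIC points vanishes identically. [folklore] -/
theorem eqOn_zero_of_algebraic {G : Set (Fin 1 → ℝ)} (hGo : IsOpen G) {f : (Fin 1 → ℝ) → ℝ}
    (hf : ContinuousOn f G) (h : ∀ x ∈ G, (∀ i, IsAlgebraic ℚ (x i)) → f x = 0) : EqOn f 0 G := by
  have hA : EqOn f 0 (G ∩ {x | ∀ i, IsAlgebraic ℚ (x i)}) := fun x hx => h x hx.1 hx.2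
  exact hA.of_subset_closure hf continuousOn_const inter_subset_left
    (dense_setOf_isAlgebraic.open_subset_closure_inter hGo)

/-! ### Uniform relations from pointwise Baker -/

/-- **The constant term vanishes identically** (two logarithms). [Baker1975 Thm 2.1; folklore] -/
theorem const_term_eq_zero_two_logs {G : Set (Fin 1 → ℝ)} (hGo : IsOpen G)
    {c₀ c₁ c₂ w₁ w₂ : (Fin 1 → ℝ) → ℝ} (hc₀ : IsSemialgebraicFunOn ℚ G c₀)
    (hc₁ : IsSemialgebraicFunOn ℚ G c₁) (hc₂ : IsSemialgebraicFunOn ℚ G c₂)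
    (hw₁ : IsSemialgebraicFunOn ℚ G w₁) (hw₂ : IsSemialgebraicFunOn ℚ G w₂)
    (cc₀ : ContinuousOn c₀ G) (hpos₁ : ∀ x ∈ G, 0 < w₁ x) (hpos₂ : ∀ x ∈ G, 0 < w₂ x)
    (hrel : ∀ x ∈ G, c₁ x * Real.log (w₁ x) + c₂ x * Real.log (w₂ x) = c₀ x) :
    EqOn c₀ 0 G :=
  eqOn_zero_of_algebraic hGo cc₀ fun x hx hxA =>
    (CircleBaker.two_logs (hpos₁ x hx) (hpos₂ x hx) (hw₁.isAlgebraic_apply hx hxA)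
      (hw₂.isAlgebraic_apply hx hxA) (hc₁.isAlgebraic_apply hx hxA) (hc₂.isAlgebraic_apply hx hxA)
      (hc₀.isAlgebraic_apply hx hxA) (hrel x hx)).1

/-- **Uniform multiplicative relation for two logarithms.** On an open `ℚ`-semialgebraic `G ⊆ ℝ¹`
let `c₁ log w₁ + c₂ log w₂ = 0` with `ℚ`-semialgebraic `cᵢ` (continuous), `wᵢ > 0`, `w₁ ≠ 1`,
`c₂ ≠ 0`.  Then locally `c₁ = q c₂` and `log w₂ = −q log w₁` for a CONSTANT RATIONAL `q`
(i.e. `w₂^n = w₁^{-p}` uniformly, `q = p/n`): pointwise Baker makes `c₁/c₂` rational at algebraic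
points, and a rational-valued semialgebraic function is locally constant. [Baker1975 Thm 2.1; folklore] -/
theorem uniform_ratio_two_logs {G : Set (Fin 1 → ℝ)} (hG : IsSemialgebraic ℚ G) (hGo : IsOpen G)
    {c₁ c₂ w₁ w₂ : (Fin 1 → ℝ) → ℝ} (hc₁ : IsSemialgebraicFunOn ℚ G c₁)
    (hc₂ : IsSemialgebraicFunOn ℚ G c₂) (hw₁ : IsSemialgebraicFunOn ℚ G w₁)
    (hw₂ : IsSemialgebraicFunOn ℚ G w₂) (cc₁ : ContinuousOn c₁ G) (cc₂ : ContinuousOn c₂ G)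
    (hpos₁ : ∀ x ∈ G, 0 < w₁ x) (hpos₂ : ∀ x ∈ G, 0 < w₂ x) (hne₁ : ∀ x ∈ G, w₁ x ≠ 1)
    (hc₂0 : ∀ x ∈ G, c₂ x ≠ 0)
    (hrel : ∀ x ∈ G, c₁ x * Real.log (w₁ x) + c₂ x * Real.log (w₂ x) = 0) :
    ∀ x₀ ∈ G, ∃ ε > 0, ∃ q : ℚ, Metric.ball x₀ ε ⊆ G ∧ ∀ x ∈ Metric.ball x₀ ε,
      c₁ x = q * c₂ x ∧ Real.log (w₂ x) = -(q : ℝ) * Real.log (w₁ x) := by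
  intro x₀ hx₀
  obtain ⟨ε, hε, hball⟩ := Metric.isOpen_iff.1 hGo x₀ hx₀
  have hr : IsSemialgebraicFunOn ℚ G (fun x => c₁ x / c₂ x) := hc₁.div hc₂ hc₂0
  have hrc : ContinuousOn (fun x => c₁ x / c₂ x) (Metric.ball x₀ ε) :=
    (cc₁.mono hball).div (cc₂.mono hball) fun x hx => hc₂0 x (hball hx)
  have hrat : ∀ x ∈ Metric.ball x₀ ε, (∀ i, IsAlgebraic ℚ (x i)) →
      ∃ q : ℚ, c₁ x / c₂ x = q := by
    intro x hx hxA
    have hxG := hball hx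
    obtain ⟨-, h2⟩ := CircleBaker.two_logs (hpos₁ x hxG) (hpos₂ x hxG)
      (hw₁.isAlgebraic_apply hxG hxA) (hw₂.isAlgebraic_apply hxG hxA)
      (hc₁.isAlgebraic_apply hxG hxA) (hc₂.isAlgebraic_apply hxG hxA) isAlgebraic_zero (hrel x hxG)
    obtain ⟨q, hq⟩ := h2 (hne₁ x hxG) (hc₂0 x hxG)
    exact ⟨q, by rw [hq, mul_div_assoc, div_self (hc₂0 x hxG), mul_one]⟩
  have hconst := eqOn_const_of_rational_at_algebraic hG hr hball hrc hrat
  -- name the constant: the value at an algebraic point of the ball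
  obtain ⟨a, haA, haB⟩ := dense_setOf_isAlgebraic.exists_mem_open Metric.isOpen_ball
    ⟨x₀, Metric.mem_ball_self hε⟩
  obtain ⟨q, hq⟩ := hrat a haB haA
  refine ⟨ε, hε, q, hball, fun x hx => ?_⟩
  have hx' : c₁ x / c₂ x = q := by rw [hconst x hx, ← hconst a haB, hq]
  have h1 : c₁ x = q * c₂ x := by
    rw [← hx', div_mul_cancel₀ _ (hc₂0 x (hball hx))]
  refine ⟨h1, ?_⟩
  have h2 := hrel x (hball hx)
  rw [h1] at h2
  have hc := hc₂0 x (hball hx)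
  apply mul_left_cancel₀ hc
  linear_combination h2

/-- **Uniform relation for two arctangents** (two families of algebraic points of `𝕊¹`): as
`uniform_ratio_two_logs`, with `d₁ ≠ 0` in place of `w₁ ≠ 1`. [Baker1975 Thm 2.1; folklore] -/
theorem uniform_ratio_two_arctans {G : Set (Fin 1 → ℝ)} (hG : IsSemialgebraic ℚ G) (hGo : IsOpen G)
    {c₁ c₂ d₁ d₂ : (Fin 1 → ℝ) → ℝ} (hc₁ : IsSemialgebraicFunOn ℚ G c₁)
    (hc₂ : IsSemialgebraicFunOn ℚ G c₂) (hd₁ : IsSemialgebraicFunOn ℚ G d₁)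
    (hd₂ : IsSemialgebraicFunOn ℚ G d₂) (cc₁ : ContinuousOn c₁ G) (cc₂ : ContinuousOn c₂ G)
    (hne₁ : ∀ x ∈ G, d₁ x ≠ 0) (hc₂0 : ∀ x ∈ G, c₂ x ≠ 0)
    (hrel : ∀ x ∈ G, c₁ x * Real.arctan (d₁ x) + c₂ x * Real.arctan (d₂ x) = 0) :
    ∀ x₀ ∈ G, ∃ ε > 0, ∃ q : ℚ, Metric.ball x₀ ε ⊆ G ∧ ∀ x ∈ Metric.ball x₀ ε,
      c₁ x = q * c₂ x ∧ Real.arctan (d₂ x) = -(q : ℝ) * Real.arctan (d₁ x) := by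
  intro x₀ hx₀
  obtain ⟨ε, hε, hball⟩ := Metric.isOpen_iff.1 hGo x₀ hx₀
  have hr : IsSemialgebraicFunOn ℚ G (fun x => c₁ x / c₂ x) := hc₁.div hc₂ hc₂0
  have hrc : ContinuousOn (fun x => c₁ x / c₂ x) (Metric.ball x₀ ε) :=
    (cc₁.mono hball).div (cc₂.mono hball) fun x hx => hc₂0 x (hball hx)
  have hrat : ∀ x ∈ Metric.ball x₀ ε, (∀ i, IsAlgebraic ℚ (x i)) →
      ∃ q : ℚ, c₁ x / c₂ x = q := by
    intro x hx hxA
    have hxG := hball hx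
    obtain ⟨-, h2⟩ := CircleBaker.two_arctans (hd₁.isAlgebraic_apply hxG hxA)
      (hd₂.isAlgebraic_apply hxG hxA) (hc₁.isAlgebraic_apply hxG hxA)
      (hc₂.isAlgebraic_apply hxG hxA) isAlgebraic_zero (hrel x hxG)
    obtain ⟨q, hq⟩ := h2 (hne₁ x hxG) (hc₂0 x hxG)
    exact ⟨q, by rw [hq, mul_div_assoc, div_self (hc₂0 x hxG), mul_one]⟩
  have hconst := eqOn_const_of_rational_at_algebraic hG hr hball hrc hrat
  obtain ⟨a, haA, haB⟩ := dense_setOf_isAlgebraic.exists_mem_open Metric.isOpen_ball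
    ⟨x₀, Metric.mem_ball_self hε⟩
  obtain ⟨q, hq⟩ := hrat a haB haA
  refine ⟨ε, hε, q, hball, fun x hx => ?_⟩
  have hx' : c₁ x / c₂ x = q := by rw [hconst x hx, ← hconst a haB, hq]
  have h1 : c₁ x = q * c₂ x := by
    rw [← hx', div_mul_cancel₀ _ (hc₂0 x (hball hx))]
  refine ⟨h1, ?_⟩
  have h2 := hrel x (hball hx)
  rw [h1] at h2
  have hc := hc₂0 x (hball hx)
  apply mul_left_cancel₀ hc
  linear_combination h2

/-- **Mixed relations are trivial.** On an open `G ⊆ ℝ¹`, `c₁ log w + c₂ arctan d = 0` with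
`ℚ`-semialgebraic data, `w > 0`, `c₁ c₂ ≠ 0` everywhere and `w, d` continuous forces `w ≡ 1` and
`d ≡ 0` on `G`. [Baker1975 Thm 2.1; folklore] -/
theorem log_arctan_rigid {G : Set (Fin 1 → ℝ)} (hGo : IsOpen G)
    {c₁ c₂ w d : (Fin 1 → ℝ) → ℝ} (hc₁ : IsSemialgebraicFunOn ℚ G c₁)
    (hc₂ : IsSemialgebraicFunOn ℚ G c₂) (hw : IsSemialgebraicFunOn ℚ G w)
    (hd : IsSemialgebraicFunOn ℚ G d) (cw : ContinuousOn w G) (cd : ContinuousOn d G)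
    (hpos : ∀ x ∈ G, 0 < w x) (hc₁0 : ∀ x ∈ G, c₁ x ≠ 0) (hc₂0 : ∀ x ∈ G, c₂ x ≠ 0)
    (hrel : ∀ x ∈ G, c₁ x * Real.log (w x) + c₂ x * Real.arctan (d x) = 0) :
    EqOn w 1 G ∧ EqOn d 0 G := by
  have hpt : ∀ x ∈ G, (∀ i, IsAlgebraic ℚ (x i)) → w x = 1 ∧ d x = 0 := fun x hx hxA =>
    (CircleBaker.log_arctan (hpos x hx) (hw.isAlgebraic_apply hx hxA) (hd.isAlgebraic_apply hx hxA)
      (hc₁.isAlgebraic_apply hx hxA) (hc₂.isAlgebraic_apply hx hxA) isAlgebraic_zero (hrel x hx)).2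
      (hc₁0 x hx) (hc₂0 x hx)
  constructor
  · have h := eqOn_zero_of_algebraic hGo (f := fun x => w x - 1)
      (cw.sub (continuousOn_const (c := (1 : ℝ)))) fun x hx hxA => by
        simp only [(hpt x hx hxA).1, sub_self]
    intro x hx
    have := h hx
    simp only [Pi.zero_apply] at this
    exact sub_eq_zero.1 this
  · exact eqOn_zero_of_algebraic hGo cd fun x hx hxA => (hpt x hx hxA).2



end RegularisedLogLayer

end Summit.KontsevichZagierPeriods.RootDecompRelativeModAbsolute.Rung30571

end
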